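import Mathlib
import HarnessLib
import Summits.ResolutionOfSingularities.ResolutionOfSingularities.Theorems.WildQuotientsWildQuotientResolutionThirdConeChartCube
import Summits.ResolutionOfSingularities.ResolutionOfSingularities.Theorems.WildQuotientsWildQuotientResolutionThirdConeWeightSplit

/-!
# Theorem T3, chart (R3): the mixed charts `D₊(x_i x_z t)` of `Bl_𝔪 ⅓(1^a,2^b) × 𝔸^c` are affine spaces
(crux stmt-ResolutionOfSingularities-15640, line `Sketch`; chain w45c next rung R-T, RT-LADDER v1.2 §5
«conjecture T3», res-L1-w45c-plan-1 GO 2026-08-27T10:03:49Z; vocabulary `ThirdCone.*` (p522660),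
tools of `…ThirdConeChartCube` (p524492); [OURS · L1 W4.5c] — NOT a statement of any manuscript.)
`ThirdCone.isRegularRing_chartRing_mixed`: for `w i = 1`, `w z = 2`, the chart of `Bl_𝔪 cone` at the
vertex generator `x_i x_z` has the POLYNOMIAL chart ring `k[x_i²/x_z, x_z²/x_i, x_s/x_i (w_s = 1),
x_s/x_z (w_s = 2), passengers]`: chart map `φ : x_s ↦ x_s x_i^{a_s} x_z^{b_s}/(x_ix_z)`, range = the
affine blow-up algebra (`x^e = φ(x_i^u x_z^v ∏ x_s^{e_s})`, `3u = 2α + β`, `3v = α + 2β`), injective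
(after `x_i ↦ x_i²x_z`, `x_z ↦ x_ix_z²` it is `x_i ↦ x_i³`, `x_z ↦ x_z³`, `ToricExit.powSubst_injective`).
-/

-- single-problem summit: the doubled namespace component `ResolutionOfSingularities` is forced
set_option linter.dupNamespace false

noncomputable section

open MvPolynomial IsLocalization
open Literature.AlgebraicGeometry.Resolution

namespace Summit.ResolutionOfSingularities.ResolutionOfSingularities.Theorems.WildQuotientResolution.ThirdCone

variable (k : Type) [Field k] (n : ℕ) (w : Fin n → ZMod 3)

/-! ## The vertex chart `D₊(x_i x_z t)` (`w i = 1`, `w z = 2`) is an affine space -/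

-- many small identities in the localisation; the proof is an explicit chart map
set_option maxHeartbeats 4000000 in
/-- **(R3) The mixed chart.** If the `j`-th vertex generator is `x_i x_z` (`w i = 1`, `w z = 2`), the
chart ring `(cone[𝔪t])_{(x_ix_z t)}` of `Bl_𝔪 ⅓(w)` is the polynomial ring
`k[x_i²/x_z, x_z²/x_i, x_s/x_i (w s = 1), x_s/x_z (w s = 2), passengers]`, in particular regular.
[OURS · L1 W4.5c] -/
theorem isRegularRing_chartRing_mixed (j : Fin (Fintype.card (VIdx n w))) (i z : Fin n)
    (hi : w i = 1) (hz : w z = 2)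
    (hj : ((vertexFamily k n w j : cone k n w) : MvPolynomial (Fin n) k) = X i * X z) :
    IsRegularRing (chartRing (vertexFamily k n w) j) := by
  classical
  let c := vertexFamily k n w
  let g : cone k n w := c j
  let L := Localization.Away g
  let am : cone k n w →+* L := algebraMap _ L
  let ι : L := IsLocalization.Away.invSelf g
  have hinv : am g * ι = 1 := IsLocalization.Away.mul_invSelf (S := L) g
  have hg : ((g : cone k n w) : MvPolynomial (Fin n) k) = X i * X z := hj
  haveI : IsRegularRing (MvPolynomial (Fin n) k) := MvPolynomial.isRegularRing_of_isRegularRing k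
  have hiz : i ≠ z := fun h => by rw [h, hz] at hi; exact absurd hi (by decide)
  have hzi : z ≠ i := fun h => hiz h.symm
  let a : Fin n → ℕ := fun s => if s = i then 2 else if s = z then 0 else if w s = 1 then 0 else 1
  let b : Fin n → ℕ := fun s => if s = z then 2 else if s = i then 0 else if w s = 2 then 0 else 1
  have hai : a i = 2 := by simp [a]
  have hbi : b i = 0 := by simp [b, hiz]
  have haz : a z = 0 := by simp [a, hzi]
  have hbz : b z = 2 := by simp [b]
  have ha1 : ∀ s, s ≠ i → s ≠ z → w s = 1 → a s = 0 ∧ b s = 1 := fun s hsi hsz hs => by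
    simp +decide [a, b, hsi, hsz, hs]
  have ha2 : ∀ s, s ≠ i → s ≠ z → w s = 2 → a s = 1 ∧ b s = 0 := fun s hsi hsz hs => by
    simp +decide [a, b, hsi, hsz, hs]
  have ha0 : ∀ s, s ≠ i → s ≠ z → w s = 0 → a s = 1 ∧ b s = 1 := fun s hsi hsz hs => by
    simp +decide [a, b, hsi, hsz, hs]
  -- the chart numerators `m s = x_s x_i^{a s} x_z^{b s}`
  have hm_mem : ∀ s, (X s * X i ^ a s * X z ^ b s : MvPolynomial (Fin n) k) ∈ cone k n w := by
    intro s
    rw [mem_cone_iff]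
    have h := ((isWeightedHomogeneous_X k w s).mul ((isWeightedHomogeneous_X k w i).pow (a s))).mul
      ((isWeightedHomogeneous_X k w z).pow (b s))
    have hdeg : w s + a s • w i + b s • w z = 0 := by
      rw [hi, hz, nsmul_eq_mul, nsmul_eq_mul, mul_one]
      by_cases hsi : s = i
      · rw [hsi, hai, hbi, hi]; decide
      by_cases hsz : s = z
      · rw [hsz, haz, hbz, hz]; decide
      rcases eq_zero_or_one_or_two (w s) with hs | hs | hs
      · rw [(ha0 s hsi hsz hs).1, (ha0 s hsi hsz hs).2, hs]; decide
      · rw [(ha1 s hsi hsz hs).1, (ha1 s hsi hsz hs).2, hs]; decide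
      · rw [(ha2 s hsi hsz hs).1, (ha2 s hsi hsz hs).2, hs]; decide
    rwa [hdeg] at h
  let mA : Fin n → cone k n w := fun s => ⟨X s * X i ^ a s * X z ^ b s, hm_mem s⟩
  have hmA : ∀ s, ((mA s : cone k n w) : MvPolynomial (Fin n) k) = X s * X i ^ a s * X z ^ b s :=
    fun s => rfl
  -- products of powers of variables as monomials (for matching the vertex generators)
  have hXmono : ∀ (s : Fin n) (p q : ℕ), (X s * X i ^ p * X z ^ q : MvPolynomial (Fin n) k) =
      monomial (Finsupp.single s 1 + p • Finsupp.single i 1 + q • Finsupp.single z 1) 1 := by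
    intro s p q
    simp only [X, monomial_pow, monomial_mul, one_pow, mul_one]
  -- the numerators lie in the vertex ideal
  have hmA_mem : ∀ s, mA s ∈ Ideal.span (Set.range c) := by
    intro s
    by_cases hsi : s = i
    · have : mA s = vertexGen k n w (Sum.inl (⟨i, hi⟩, ⟨i, hi⟩, ⟨i, hi⟩)) := Subtype.ext (by
        rw [hmA, coe_vertexGen, vertexExp, hsi, hai, hbi, hXmono]
        refine congrArg (fun ee => (monomial ee (1 : k) : MvPolynomial (Fin n) k)) ?_
        ext t
        simp only [Finsupp.add_apply, Finsupp.smul_apply, Finsupp.single_apply, smul_eq_mul]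
        split_ifs <;> omega)
      rw [this]; exact vertexGen_mem_vertexIdeal k n w _
    by_cases hsz : s = z
    · have : mA s = vertexGen k n w (Sum.inr (Sum.inl (⟨z, hz⟩, ⟨z, hz⟩, ⟨z, hz⟩))) := Subtype.ext (by
        rw [hmA, coe_vertexGen, vertexExp, hsz, haz, hbz, hXmono]
        refine congrArg (fun ee => (monomial ee (1 : k) : MvPolynomial (Fin n) k)) ?_
        ext t
        simp only [Finsupp.add_apply, Finsupp.smul_apply, Finsupp.single_apply, smul_eq_mul]
        split_ifs <;> omega)
      rw [this]; exact vertexGen_mem_vertexIdeal k n w _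
    rcases eq_zero_or_one_or_two (w s) with hs | hs | hs
    · -- passenger: `x_s x_i x_z = x_s · g`
      have hXs : (X s : MvPolynomial (Fin n) k) ∈ cone k n w := by
        rw [mem_cone_iff]; simpa [hs] using isWeightedHomogeneous_X k w s
      have : mA s = ⟨X s, hXs⟩ * g := Subtype.ext (by
        rw [Subalgebra.coe_mul, hmA, hg, (ha0 s hsi hsz hs).1, (ha0 s hsi hsz hs).2, pow_one, pow_one,
          mul_assoc])
      rw [this]
      exact Ideal.mul_mem_left _ _ (Ideal.subset_span ⟨j, rfl⟩)
    · have : mA s = vertexGen k n w (Sum.inr (Sum.inr (⟨s, hs⟩, ⟨z, hz⟩))) := Subtype.ext (by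
        rw [hmA, coe_vertexGen, vertexExp, (ha1 s hsi hsz hs).1, (ha1 s hsi hsz hs).2, hXmono]
        refine congrArg (fun ee => (monomial ee (1 : k) : MvPolynomial (Fin n) k)) ?_
        ext t
        simp only [Finsupp.add_apply, Finsupp.smul_apply, Finsupp.single_apply, smul_eq_mul]
        split_ifs <;> omega)
      rw [this]; exact vertexGen_mem_vertexIdeal k n w _
    · have : mA s = vertexGen k n w (Sum.inr (Sum.inr (⟨i, hi⟩, ⟨s, hs⟩))) := Subtype.ext (by
        rw [hmA, coe_vertexGen, vertexExp, (ha2 s hsi hsz hs).1, (ha2 s hsi hsz hs).2, hXmono]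
        refine congrArg (fun ee => (monomial ee (1 : k) : MvPolynomial (Fin n) k)) ?_
        ext t
        simp only [Finsupp.add_apply, Finsupp.smul_apply, Finsupp.single_apply, smul_eq_mul]
        split_ifs <;> omega)
      rw [this]; exact vertexGen_mem_vertexIdeal k n w _
  -- the chart map `φ : x_s ↦ m_s / (x_i x_z)`
  let φ : MvPolynomial (Fin n) k →ₐ[k] L := aeval fun s => am (mA s) * ι
  have hφ : ∀ s, φ (X s) = am (mA s) * ι := fun s => by simp [φ]
  have hφC : ∀ r : k, φ (C r) = am (algebraMap k (cone k n w) r) := fun r => by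
    rw [aeval_C, IsScalarTower.algebraMap_apply k (cone k n w) L]
  -- `φ(x_i x_z) = g`
  have hgcube : mA i * mA z = g ^ 3 := Subtype.ext (by
    rw [Subalgebra.coe_mul, Subalgebra.coe_pow, hmA, hmA, hg, hai, hbi, haz, hbz]; ring)
  have hφg : φ (X i * X z) = am g := by
    rw [map_mul, hφ, hφ]
    calc am (mA i) * ι * (am (mA z) * ι) = am (mA i * mA z) * ι ^ 2 := by rw [map_mul]; ring
      _ = am g * (am g * ι) ^ 2 := by rw [hgcube, map_pow]; ring
      _ = am g := by rw [hinv, one_pow, mul_one]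
  -- (I) values in the blow-up algebra
  have hmem : ∀ x, (φ : MvPolynomial (Fin n) k →+* L) x ∈
      blowupAlgebra (Ideal.span (Set.range c)) (c j) := by
    intro x
    induction x using MvPolynomial.induction_on with
    | C r => rw [RingHom.coe_coe, hφC]; exact Subalgebra.algebraMap_mem _ _
    | add p q hp hq => rw [map_add]; exact Subalgebra.add_mem _ hp hq
    | mul_X p s hp =>
      rw [map_mul]
      refine Subalgebra.mul_mem _ hp ?_
      rw [RingHom.coe_coe, hφ s]; exact div_mem_blowupAlgebra _ _ (hmA_mem s)
  -- (II) the master monomial identity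
  let S : Finset (Fin n) := (Finset.univ.erase i).erase z
  have hzS : z ∈ Finset.univ.erase i := Finset.mem_erase.mpr ⟨hzi, Finset.mem_univ z⟩
  have hmemS : ∀ s ∈ S, s ≠ i ∧ s ≠ z := fun s hs => by
    simp only [S, Finset.mem_erase] at hs; exact ⟨hs.2.1, hs.1⟩
  let α : (Fin n →₀ ℕ) → ℕ := fun e => ∑ s, e s * (if w s = 1 then 1 else 0)
  let β : (Fin n →₀ ℕ) → ℕ := fun e => ∑ s, e s * (if w s = 2 then 1 else 0)
  have hdiv : ∀ e : Fin n →₀ ℕ, Finsupp.weight w e = 0 →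
      3 ∣ 2 * α e + β e ∧ 3 ∣ α e + 2 * β e := by
    intro e he
    rw [weight_eq_chi] at he
    have h2 : 3 ∣ α e + 2 * β e := by
      apply (ZMod.natCast_eq_zero_iff _ _).mp
      push_cast
      exact he
    exact ⟨by omega, h2⟩
  -- splitting sums over `univ` at `i` and `z`
  have hsplit : ∀ f : Fin n → ℕ, ∑ s, f s = f i + (f z + ∑ s ∈ S, f s) := fun f => by
    rw [← Finset.add_sum_erase _ _ (Finset.mem_univ i), ← Finset.add_sum_erase _ _ hzS]
  have hsplitM : ∀ f : Fin n → MvPolynomial (Fin n) k, ∏ s, f s = f i * (f z * ∏ s ∈ S, f s) :=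
    fun f => by rw [← Finset.mul_prod_erase _ _ (Finset.mem_univ i), ← Finset.mul_prod_erase _ _ hzS]
  have master : ∀ (e : Fin n →₀ ℕ) (he : Finsupp.weight w e = 0) (u v : ℕ),
      3 * u = 2 * α e + β e → 3 * v = α e + 2 * β e →
      φ (X i ^ u * X z ^ v * ∏ s ∈ S, X s ^ e s) =
        am ⟨monomial e 1, monomial_mem_cone k n w he 1⟩ := by
    intro e he u v hu hv
    have hP : φ (∏ s ∈ S, X s ^ e s) =
        (∏ s ∈ S, am (mA s) ^ e s) * ι ^ (∑ s ∈ S, e s) := by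
      rw [map_prod, ← Finset.prod_pow_eq_pow_sum, ← Finset.prod_mul_distrib]
      refine Finset.prod_congr rfl fun s _ => ?_
      rw [map_pow, hφ s, mul_pow]
    have hL : φ (X i ^ u * X z ^ v * ∏ s ∈ S, X s ^ e s) =
        am (mA i) ^ u * am (mA z) ^ v * (∏ s ∈ S, am (mA s) ^ e s) *
          ι ^ (u + v + ∑ s ∈ S, e s) := by
      rw [map_mul, map_mul, map_pow, map_pow, hφ, hφ, hP]; ring
    have hA' : (∑ s ∈ S, a s * e s) + ∑ s ∈ S, e s * (if w s = 1 then 1 else 0) = ∑ s ∈ S, e s := by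
      rw [← Finset.sum_add_distrib]
      refine Finset.sum_congr rfl fun s hs => ?_
      obtain ⟨hsi, hsz⟩ := hmemS s hs
      rcases eq_zero_or_one_or_two (w s) with h | h | h
      · rw [(ha0 s hsi hsz h).1, h]; simp +decide
      · rw [(ha1 s hsi hsz h).1, h]; simp +decide
      · rw [(ha2 s hsi hsz h).1, h]; simp +decide
    have hB' : (∑ s ∈ S, b s * e s) + ∑ s ∈ S, e s * (if w s = 2 then 1 else 0) = ∑ s ∈ S, e s := by
      rw [← Finset.sum_add_distrib]
      refine Finset.sum_congr rfl fun s hs => ?_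
      obtain ⟨hsi, hsz⟩ := hmemS s hs
      rcases eq_zero_or_one_or_two (w s) with h | h | h
      · rw [(ha0 s hsi hsz h).2, h]; simp +decide
      · rw [(ha1 s hsi hsz h).2, h]; simp +decide
      · rw [(ha2 s hsi hsz h).2, h]; simp +decide
    have hα : α e = e i + ∑ s ∈ S, e s * (if w s = 1 then 1 else 0) := by
      show (∑ s, e s * (if w s = 1 then 1 else 0)) = _
      rw [hsplit (fun s => e s * (if w s = 1 then 1 else 0)), hi, hz]; simp +decide
    have hβ : β e = e z + ∑ s ∈ S, e s * (if w s = 2 then 1 else 0) := by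
      show (∑ s, e s * (if w s = 2 then 1 else 0)) = _
      rw [hsplit (fun s => e s * (if w s = 2 then 1 else 0)), hi, hz]; simp +decide
    have hK1 : 3 * u + ∑ s ∈ S, a s * e s = e i + (u + v + ∑ s ∈ S, e s) := by omega
    have hK2 : 3 * v + ∑ s ∈ S, b s * e s = e z + (u + v + ∑ s ∈ S, e s) := by omega
    -- the identity in the cone (checked on polynomials)
    have hA : mA i ^ u * mA z ^ v * ∏ s ∈ S, mA s ^ e s =
        ⟨monomial e 1, monomial_mem_cone k n w he 1⟩ * g ^ (u + v + ∑ s ∈ S, e s) := by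
      apply Subtype.ext
      simp only [Subalgebra.coe_mul, Subalgebra.coe_pow, SubmonoidClass.coe_finsetProd, hmA, hg, hai,
        hbi, haz, hbz]
      rw [monomial_one_eq_prod_X_pow, hsplitM (fun s => X s ^ e s)]
      simp only [mul_pow, ← pow_mul, Finset.prod_mul_distrib, Finset.prod_pow_eq_pow_sum, pow_zero,
        mul_one]
      calc _ = (X i : MvPolynomial (Fin n) k) ^ (3 * u + ∑ s ∈ S, a s * e s) *
              X z ^ (3 * v + ∑ s ∈ S, b s * e s) * ∏ s ∈ S, X s ^ e s := by ring
        _ = X i ^ (e i + (u + v + ∑ s ∈ S, e s)) * X z ^ (e z + (u + v + ∑ s ∈ S, e s)) *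
              ∏ s ∈ S, X s ^ e s := by rw [hK1, hK2]
        _ = _ := by ring
    have hA' := congrArg am hA
    simp only [map_mul, map_pow, map_prod] at hA'
    rw [hL, hA', mul_assoc, ← mul_pow, hinv, one_pow, mul_one]
  have hmono : ∀ (e : Fin n →₀ ℕ) (he : Finsupp.weight w e = 0),
      am ⟨monomial e 1, monomial_mem_cone k n w he 1⟩ ∈
        Set.range (φ : MvPolynomial (Fin n) k →+* L) := by
    intro e he
    obtain ⟨⟨u, hu⟩, ⟨v, hv⟩⟩ := hdiv e he
    exact ⟨_, master e he u v hu.symm hv.symm⟩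
  have hbase : ∀ r : cone k n w, am r ∈ Set.range (φ : MvPolynomial (Fin n) k →+* L) := by
    rintro ⟨f, hf⟩
    let μ : (Fin n →₀ ℕ) → cone k n w := fun e =>
      if he : Finsupp.weight w e = 0 then ⟨monomial e 1, monomial_mem_cone k n w he 1⟩ else 0
    have hμ : ∀ (e) (he : e ∈ f.support), μ e = ⟨monomial e 1,
        monomial_mem_cone k n w (hf (Finsupp.mem_support_iff.mp he)) 1⟩ := by
      intro e he
      have hwe : Finsupp.weight w e = 0 := hf (Finsupp.mem_support_iff.mp he)
      simp [μ, hwe]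
    have hdec : (⟨f, hf⟩ : cone k n w) = ∑ e ∈ f.support, coeff e f • μ e := by
      apply Subtype.ext
      change f = ((∑ e ∈ f.support, coeff e f • μ e : cone k n w) : MvPolynomial (Fin n) k)
      rw [AddSubmonoidClass.coe_finsetSum]
      conv_lhs => rw [f.as_sum]
      refine Finset.sum_congr rfl fun e he => ?_
      rw [Subalgebra.coe_smul, hμ e he, smul_monomial, smul_eq_mul, mul_one]
    rw [hdec, map_sum]
    have hmemR : ∀ e ∈ f.support, am (coeff e f • μ e) ∈ φ.range := by
      intro e he
      have hsm : am (coeff e f • μ e) = algebraMap k L (coeff e f) * am (μ e) := by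
        rw [Algebra.smul_def, map_mul, IsScalarTower.algebraMap_apply k (cone k n w) L]
      rw [hsm]
      refine Subalgebra.mul_mem _ (Subalgebra.algebraMap_mem _ _) ?_
      rw [hμ e he]
      obtain ⟨Q, hQ⟩ := hmono e (hf (Finsupp.mem_support_iff.mp he))
      exact φ.mem_range.mpr ⟨Q, hQ⟩
    exact φ.mem_range.mp (Subalgebra.sum_mem _ hmemR)
  -- (III) the generators `c i' / g` are values of the chart map
  have hgen : ∀ i', am (c i') * ι ∈ Set.range (φ : MvPolynomial (Fin n) k →+* L) := by
    intro i'
    let vv := (Fintype.equivFin (VIdx n w)).symm i'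
    have he0 : Finsupp.weight w (vertexExp n w vv) = 0 := weight_vertexExp n w vv
    obtain ⟨⟨u, hu⟩, ⟨v, hv⟩⟩ := hdiv _ he0
    obtain ⟨s₀, hs₀w, hs₀e⟩ := exists_pos_vertexExp n w vv
    have hαβ : 1 ≤ α (vertexExp n w vv) + β (vertexExp n w vv) := by
      have h1 : vertexExp n w vv s₀ * (if w s₀ = 1 then 1 else 0) ≤ α (vertexExp n w vv) :=
        Finset.single_le_sum (f := fun s => vertexExp n w vv s * (if w s = 1 then 1 else 0))
          (fun _ _ => Nat.zero_le _) (Finset.mem_univ s₀)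
      have h2 : vertexExp n w vv s₀ * (if w s₀ = 2 then 1 else 0) ≤ β (vertexExp n w vv) :=
        Finset.single_le_sum (f := fun s => vertexExp n w vv s * (if w s = 2 then 1 else 0))
          (fun _ _ => Nat.zero_le _) (Finset.mem_univ s₀)
      rcases eq_zero_or_one_or_two (w s₀) with h | h | h
      · exact absurd h hs₀w
      · rw [h] at h1; simp at h1; omega
      · rw [h] at h2; simp at h2; omega
    obtain ⟨u', rfl⟩ : ∃ u', u = u' + 1 := ⟨u - 1, by omega⟩
    obtain ⟨v', rfl⟩ : ∃ v', v = v' + 1 := ⟨v - 1, by omega⟩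
    have hm := master _ he0 (u' + 1) (v' + 1) hu.symm hv.symm
    have hcg : (⟨monomial (vertexExp n w vv) 1, monomial_mem_cone k n w he0 1⟩ : cone k n w) =
        c i' := Subtype.ext rfl
    have hsplit2 : (X i : MvPolynomial (Fin n) k) ^ (u' + 1) * X z ^ (v' + 1) *
        ∏ s ∈ S, X s ^ vertexExp n w vv s =
        (X i * X z) * (X i ^ u' * X z ^ v' * ∏ s ∈ S, X s ^ vertexExp n w vv s) := by ring
    rw [hcg, hsplit2, map_mul, hφg] at hm
    refine ⟨X i ^ u' * X z ^ v' * ∏ s ∈ S, X s ^ vertexExp n w vv s, ?_⟩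
    rw [RingHom.coe_coe]
    calc φ (X i ^ u' * X z ^ v' * ∏ s ∈ S, X s ^ vertexExp n w vv s)
        = φ (X i ^ u' * X z ^ v' * ∏ s ∈ S, X s ^ vertexExp n w vv s) * (am g * ι) := by
          rw [hinv, mul_one]
      _ = am (c i') * ι := by rw [← hm]; ring
  -- (IV) injectivity: `Ψ ∘ Θ ∘ φ = alg ∘ E`
  let A' := Localization.Away (X i * X z : MvPolynomial (Fin n) k)
  let alg : MvPolynomial (Fin n) k →+* A' := algebraMap _ A'
  have halg : Function.Injective alg :=
    JordanThree.algebraMap_away_injective k n (X i * X z) (mul_ne_zero (X_ne_zero i) (X_ne_zero z))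
  let θ : cone k n w →+* MvPolynomial (Fin n) k := (cone k n w).val.toRingHom
  have hθ : ∀ r : cone k n w, θ r = (r : MvPolynomial (Fin n) k) := fun r => rfl
  have hunit : IsUnit ((alg.comp θ) g) := by
    change IsUnit (alg (θ g))
    rw [hθ, hg]
    exact IsLocalization.Away.algebraMap_isUnit (S := A') (X i * X z)
  let Θ : L →+* A' := IsLocalization.Away.lift g hunit
  have hΘam : ∀ r, Θ (am r) = alg (r : MvPolynomial (Fin n) k) := fun r =>
    IsLocalization.Away.lift_eq g hunit r
  have hΘι : alg (X i * X z) * Θ ι = 1 := by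
    have h : Θ (am g * ι) = 1 := by rw [hinv, map_one]
    rwa [map_mul, hΘam, hg] at h
  let a' : Fin n → ℕ := fun s =>
    if s = i then 1 else if s = z then 1 else if w s = 1 then 2 else if w s = 2 then 1 else 0
  let b' : Fin n → ℕ := fun s =>
    if s = i then 1 else if s = z then 1 else if w s = 1 then 1 else if w s = 2 then 2 else 0
  let ψ : MvPolynomial (Fin n) k →ₐ[k] MvPolynomial (Fin n) k :=
    aeval fun s => X s * X i ^ a' s * X z ^ b' s
  have hψ : ∀ s, ψ (X s) = X s * X i ^ a' s * X z ^ b' s := fun s => by simp [ψ]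
  have hψC : ∀ r : k, ψ (C r) = C r := fun r => ψ.commutes r
  have hψi : ψ (X i) = X i ^ 2 * X z := by rw [hψ]; simp [a', b']; ring
  have hψz : ψ (X z) = X i * X z ^ 2 := by rw [hψ]; simp [a', b', hzi]; ring
  have hψg : ψ (X i * X z) = (X i * X z) ^ 3 := by rw [map_mul, hψi, hψz]; ring
  have hle : Submonoid.powers (X i * X z : MvPolynomial (Fin n) k) ≤
      (Submonoid.powers (X i * X z : MvPolynomial (Fin n) k)).comap
        (ψ : MvPolynomial (Fin n) k →+* MvPolynomial (Fin n) k) := by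
    rintro _ ⟨m, rfl⟩
    exact ⟨3 * m, by rw [RingHom.coe_coe, map_pow, hψg, ← pow_mul]⟩
  let Ψ : A' →+* A' :=
    IsLocalization.map A' (ψ : MvPolynomial (Fin n) k →+* MvPolynomial (Fin n) k) hle
  have hΨ : ∀ f, Ψ (alg f) = alg (ψ f) := fun f => IsLocalization.map_eq hle f
  have hΨΘι : alg (X i * X z) ^ 3 * Ψ (Θ ι) = 1 := by
    have h := congrArg Ψ hΘι
    rwa [map_mul, hΨ, hψg, map_one, map_pow] at h
  let E : MvPolynomial (Fin n) k →ₐ[k] MvPolynomial (Fin n) k :=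
    aeval fun s => if s = i then X i ^ 3 else if s = z then X z ^ 3 else X s
  have hEi : E (X i) = X i ^ 3 := by simp [E]
  have hEz : E (X z) = X z ^ 3 := by simp [E, hzi]
  have hEs : ∀ s, s ≠ i → s ≠ z → E (X s) = X s := fun s hsi hsz => by simp [E, hsi, hsz]
  have hEC : ∀ r : k, E (C r) = C r := fun r => E.commutes r
  have hψm : ∀ s, ψ ((mA s : cone k n w) : MvPolynomial (Fin n) k) = E (X s) * (X i * X z) ^ 3 := by
    intro s
    rw [hmA, map_mul, map_mul, map_pow, map_pow, hψ, hψi, hψz]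
    by_cases hsi : s = i
    · rw [hsi, hai, hbi, hEi]; simp [a', b']; ring
    by_cases hsz : s = z
    · rw [hsz, haz, hbz, hEz]; simp [a', b', hzi]; ring
    rw [hEs s hsi hsz]
    rcases eq_zero_or_one_or_two (w s) with hs | hs | hs
    · rw [(ha0 s hsi hsz hs).1, (ha0 s hsi hsz hs).2]; simp +decide [a', b', hsi, hsz, hs]; ring
    · rw [(ha1 s hsi hsz hs).1, (ha1 s hsi hsz hs).2]; simp +decide [a', b', hsi, hsz, hs]; ring
    · rw [(ha2 s hsi hsz hs).1, (ha2 s hsi hsz hs).2]; simp +decide [a', b', hsi, hsz, hs]; ring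
  have hcomp : (Ψ.comp Θ).comp (φ : MvPolynomial (Fin n) k →+* L) =
      alg.comp (E : MvPolynomial (Fin n) k →+* MvPolynomial (Fin n) k) := by
    refine MvPolynomial.ringHom_ext (fun r => ?_) (fun s => ?_)
    · simp only [RingHom.coe_comp, RingHom.coe_coe, Function.comp_apply]
      rw [hφC, hΘam, Subalgebra.coe_algebraMap, MvPolynomial.algebraMap_eq, hΨ, hψC, hEC]
    · simp only [RingHom.coe_comp, RingHom.coe_coe, Function.comp_apply]
      rw [hφ s, map_mul, hΘam, map_mul Ψ, hΨ, hψm, map_mul alg, map_pow, mul_assoc, hΨΘι, mul_one]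
  -- `E = (x_i ↦ x_i³) ∘ (x_z ↦ x_z³)` is injective
  have hEinj : Function.Injective E := by
    let E₁ : MvPolynomial (Fin n) k →ₐ[k] MvPolynomial (Fin n) k :=
      aeval fun s => if s = i then X i ^ 3 else X s
    let E₂ : MvPolynomial (Fin n) k →ₐ[k] MvPolynomial (Fin n) k :=
      aeval fun s => if s = z then X z ^ 3 else X s
    have hE12 : E = E₁.comp E₂ := by
      refine MvPolynomial.algHom_ext fun s => ?_
      rw [AlgHom.comp_apply]
      by_cases hsi : s = i
      · rw [hsi, hEi]; simp [E₁, E₂, hiz]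
      by_cases hsz : s = z
      · rw [hsz, hEz]; simp [E₁, E₂, hzi]
      rw [hEs s hsi hsz]; simp [E₁, E₂, hsi, hsz]
    rw [hE12]
    intro p q h
    exact ToricExit.powSubst_injective k n z 3 (by norm_num)
      (ToricExit.powSubst_injective k n i 3 (by norm_num) h)
  have hinj : Function.Injective (φ : MvPolynomial (Fin n) k →+* L) := by
    intro p q hpq
    have h1 : alg (E p) = alg (E q) := by
      have h := congrArg (Ψ.comp Θ) hpq
      have hp := RingHom.congr_fun hcomp p
      have hq := RingHom.congr_fun hcomp q
      rw [RingHom.comp_apply] at hp hq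
      rw [hp, hq] at h
      simpa only [RingHom.coe_comp, RingHom.coe_coe, Function.comp_apply] using h
    exact hEinj (halg h1)
  have hrange := JordanThree.range_eq_blowupAlgebra_of_chart c j
    (φ : MvPolynomial (Fin n) k →+* L) hmem hbase hgen
  exact JordanThree.isRegularRing_chartRing_of_chart c j (φ : MvPolynomial (Fin n) k →+* L)
    hinj hrange

end Summit.ResolutionOfSingularities.ResolutionOfSingularities.Theorems.WildQuotientResolution.ThirdCone

end
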